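import Mathlib
import HarnessLib
import Literature.Analysis.FluidPDE.SuitableWeak
import Literature.Analysis.FluidPDE.WeakSolutionProofs
import Literature.Analysis.FluidPDE.IsometryInvariance
import Literature.Analysis.FluidPDE.Seregin2020SingularSetAxis

/-!
# Rotation covariance of distributional solutions and weak gradients on a slab
# (helper for `RellichScar.SimilarityCovariance`)

Let `R : E ≃ₗᵢ[ℝ] E` be a linear isometry of the finite-dimensional inner product space `E`
(a rotation `R_θ` of `ℝ³` about the `x₃`-axis in the application) and let `I ⊆ ℝ` be an open
set of times. The slab `I × E` is invariant under the measure-preserving space–time map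
`Ψ(t, x) = (t, R⁻¹ x)`, and the weak notions of `SuitableWeak.lean` / `WeakSolution.lean` are
covariant under the conjugation `u ↦ R u(t, R⁻¹ x)`, `p ↦ p(t, R⁻¹ x)`, `f ↦ R f(t, R⁻¹ x)`,
`∇u = G ↦ R ∘ G(t, R⁻¹ x) ∘ R⁻¹`:

* `isSpaceTimeTestOn_comp_lie`, `isSpaceTimeTestOn_clm_comp` — test fields compose with `R`
  (on the right) and with continuous linear maps (on the left);
* `locallyIntegrableOn_comp_prodMap`, `locallyIntegrableOn_clm_apply` — local integrability on
  the slab is transported along `Ψ` and along continuous linear maps;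
* `isDistributionalNSSolutionOn_conj` — the distributional Navier–Stokes system (CKN 1982,
  (2.2)) is rotation covariant: each term of the weak formulation tested with `ψ` is the
  corresponding term for `(u, p, f)` tested with `R⁻¹ ψ(t, R ·)`, evaluated at `Ψ z`, by the
  pointwise covariance of `∂ₜ`, `(·∇)`, `Δ`, `div`, `∇` (`IsometryInvariance.lean`) and the change
  of variables `z ↦ Ψ z`;
* `hasWeakSpatialGradientOn_conj` — weak spatial gradients (CKN 1982, (2.1)) are covariant.

This is the weak form of the rotation symmetry of the Navier–Stokes equations
(Majda–Bertozzi 2002, §1.2 Prop. 1.1 (iii); KNSS 2009, §1), whose classical form is the tree's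
`IsClassicalNSSolutionOn.conj_linearIsometryEquiv`.
-/

-- the summit and its single sub-problem share the name (CONVENTIONS §1), as in every Theorems file
set_option linter.dupNamespace false

namespace Summit.NavierStokesRegularity.NavierStokesRegularity.Theorems.RellichScarSimilarityCovariance

open MeasureTheory Set Function Metric Filter TopologicalSpace
open scoped ENNReal NNReal InnerProductSpace RealInnerProductSpace Laplacian
open Literature.Analysis Literature.Analysis.FluidPDE

variable {E : Type*} [NormedAddCommGroup E] [InnerProductSpace ℝ E] [FiniteDimensional ℝ E]
  [MeasurableSpace E] [BorelSpace E]
variable {F : Type*} [NormedAddCommGroup F] [NormedSpace ℝ F]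

/-! ### Test fields -/

omit [FiniteDimensional ℝ E] [MeasurableSpace E] [BorelSpace E] in
/-- Space–time test fields on a slab compose on the right with a linear isometry of space:
`(t, y) ↦ φ t (R y)` is a test field on `I × E` if `φ` is. -/
theorem isSpaceTimeTestOn_comp_lie {I : Set ℝ} {hI : IsOpen I} {φ : ℝ → E → F}
    (hφ : IsSpaceTimeTestOn (slab E I hI) φ) (R : E ≃ₗᵢ[ℝ] E) :
    IsSpaceTimeTestOn (slab E I hI) (fun t y => φ t (R y)) := by
  set Φ : (ℝ × E) ≃L[ℝ] (ℝ × E) :=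
    (ContinuousLinearEquiv.refl ℝ ℝ).prodCongr R.toContinuousLinearEquiv with hΦ
  have heq : uncurry (fun t y => φ t (R y)) = uncurry φ ∘ Φ := by
    funext q; obtain ⟨t, y⟩ := q; rfl
  refine ⟨?_, ?_, ?_⟩
  · rw [heq]; exact hφ.contDiff.comp Φ.contDiff
  · rw [heq]
    exact hφ.hasCompactSupport.comp_homeomorph Φ.toHomeomorph
  · rw [heq, show (uncurry φ ∘ ⇑Φ) = uncurry φ ∘ ⇑Φ.toHomeomorph from rfl,
      tsupport_comp_eq_preimage]
    intro q hq
    have h1 : Φ.toHomeomorph q ∈ slab E I hI := hφ.tsupport_subset hq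
    exact (mem_slab (hI := hI)).2 ((mem_slab (hI := hI)).1 h1)

omit [FiniteDimensional ℝ E] [MeasurableSpace E] [BorelSpace E] in
/-- Space–time test fields compose on the left with a continuous linear map:
`(t, y) ↦ L (φ t y)` is a test field on `Q` if `φ` is. -/
theorem isSpaceTimeTestOn_clm_comp {F' : Type*} [NormedAddCommGroup F'] [NormedSpace ℝ F']
    {Q : Opens (ℝ × E)} {φ : ℝ → E → F} (hφ : IsSpaceTimeTestOn Q φ) (L : F →L[ℝ] F') :
    IsSpaceTimeTestOn Q (fun t y => L (φ t y)) := by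
  have heq : uncurry (fun t y => L (φ t y)) = L ∘ uncurry φ := rfl
  refine ⟨?_, ?_, ?_⟩
  · rw [heq]; exact L.contDiff.comp hφ.contDiff
  · rw [heq]; exact hφ.hasCompactSupport.comp_left (map_zero L)
  · rw [heq]
    exact (closure_mono (support_comp_subset (map_zero L) _)).trans hφ.tsupport_subset

omit [NormedAddCommGroup E] [InnerProductSpace ℝ E] [FiniteDimensional ℝ E] [MeasurableSpace E]
  [BorelSpace E] in
/-- The time derivative commutes with a continuous linear equivalence applied to the values:
`∂ₜ (L ψ) = L ∂ₜψ` (no differentiability needed: both sides are junk `0` together). -/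
theorem timeDeriv_cle_comp {X : Type*} {F' : Type*} [NormedAddCommGroup F'] [NormedSpace ℝ F']
    (L : F ≃L[ℝ] F') (ψ : ℝ → X → F) (t : ℝ) (x : X) :
    timeDeriv (fun s y => L (ψ s y)) t x = L (timeDeriv ψ t x) := by
  simp only [timeDeriv_apply]
  rw [← fderiv_apply_one_eq_deriv, ← fderiv_apply_one_eq_deriv,
    show (fun s => L (ψ s x)) = L ∘ (fun s => ψ s x) from rfl, L.comp_fderiv]
  rfl

/-! ### Local integrability along `Ψ(t, x) = (t, R x)` -/

/-- Local integrability on the slab `I × E` is transported along the measure-preserving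
homeomorphism `(t, x) ↦ (t, R x)`. -/
theorem locallyIntegrableOn_comp_prodMap {G' : Type*} [NormedAddCommGroup G']
    (R : E ≃ₗᵢ[ℝ] E) {I : Set ℝ} {Fn : ℝ × E → G'}
    (hF : LocallyIntegrableOn Fn (I ×ˢ (univ : Set E)) volume) :
    LocallyIntegrableOn (Fn ∘ Prod.map (id : ℝ → ℝ) R) (I ×ˢ (univ : Set E)) volume := by
  set Ψ : ℝ × E → ℝ × E := Prod.map (id : ℝ → ℝ) (R : E → E) with hΨ
  have hΨmp : MeasurePreserving Ψ (volume : Measure (ℝ × E)) volume :=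
    measurePreserving_prodMap_id_linearIsometryEquiv R
  have hΨemb : MeasurableEmbedding Ψ := measurableEmbedding_prodMap_id_linearIsometryEquiv R
  have hΨS : Ψ ⁻¹' (I ×ˢ (univ : Set E)) = I ×ˢ univ := by
    ext z; simp [hΨ, mem_prod]
  intro z hz
  obtain ⟨U, hU, hFU⟩ := hF (Ψ z) (by rw [← mem_preimage, hΨS]; exact hz)
  refine ⟨Ψ ⁻¹' U, ?_, ?_⟩
  · have hc : Continuous Ψ := continuous_id.prodMap R.continuous
    have := hc.continuousWithinAt.preimage_mem_nhdsWithin'' hU rfl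
    rwa [hΨS] at this
  · rw [← hΨemb.integrableOn_map_iff, hΨmp.map_eq]
    exact hFU

omit [NormedAddCommGroup E] [InnerProductSpace ℝ E] [FiniteDimensional ℝ E] [MeasurableSpace E]
  [BorelSpace E] in
/-- Local integrability is preserved by a continuous linear map applied to the values. -/
theorem locallyIntegrableOn_clm_apply {G' G'' : Type*} [NormedAddCommGroup G'] [NormedSpace ℝ G']
    [NormedAddCommGroup G''] [NormedSpace ℝ G''] {α : Type*} [MeasurableSpace α]
    [TopologicalSpace α] {μ : Measure α} {S : Set α} {Fn : α → G'} (L : G' →L[ℝ] G'')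
    (hF : LocallyIntegrableOn Fn S μ) : LocallyIntegrableOn (fun z => L (Fn z)) S μ := by
  intro z hz
  obtain ⟨U, hU, hFU⟩ := hF z hz
  exact ⟨U, hU, L.integrable_comp hFU⟩

/-! ### Distributional solutions -/

/-- **Rotation covariance of distributional Navier–Stokes solutions on a slab** (CKN 1982,
(2.2); Majda–Bertozzi 2002, Prop. 1.1 (iii)): if `(u, p)` solves the system with force `f` and
viscosity `ν` on `I × E` in the sense of distributions, then so does
`(R u(t, R⁻¹x), p(t, R⁻¹x))` with force `R f(t, R⁻¹x)`. -/
theorem isDistributionalNSSolutionOn_conj {I : Set ℝ} {hI : IsOpen I} {ν : ℝ}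
    {f u : ℝ → E → E} {p : ℝ → E → ℝ}
    (h : IsDistributionalNSSolutionOn (slab E I hI) ν f u p) (R : E ≃ₗᵢ[ℝ] E) :
    IsDistributionalNSSolutionOn (slab E I hI) ν (fun t x => R (f t (R.symm x)))
      (fun t x => R (u t (R.symm x))) (fun t x => p t (R.symm x)) := by
  obtain ⟨hu, hu2, hp, hdiv, hns⟩ := h
  set Ψ : ℝ × E → ℝ × E := Prod.map (id : ℝ → ℝ) (R.symm : E → E) with hΨ
  have hΨmp : MeasurePreserving Ψ (volume : Measure (ℝ × E)) volume :=
    measurePreserving_prodMap_id_linearIsometryEquiv R.symm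
  have hΨemb : MeasurableEmbedding Ψ := measurableEmbedding_prodMap_id_linearIsometryEquiv R.symm
  have hS : ((slab E I hI : Opens (ℝ × E)) : Set (ℝ × E)) = I ×ˢ univ := rfl
  have hΨS : Ψ ⁻¹' (I ×ˢ (univ : Set E)) = I ×ˢ univ := by
    ext z; simp [hΨ, mem_prod]
  -- change of variables on the slab
  have hcv : ∀ Fn : ℝ × E → ℝ,
      ∫ z in I ×ˢ (univ : Set E), Fn (Ψ z) = ∫ z in I ×ˢ (univ : Set E), Fn z := by
    intro Fn
    have := hΨmp.setIntegral_preimage_emb hΨemb Fn (I ×ˢ univ)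
    rwa [hΨS] at this
  refine ⟨?_, ?_, ?_, ?_, ?_⟩
  · have heq : uncurry (fun t x => R (u t (R.symm x))) =
        fun z => (R : E →L[ℝ] E) ((uncurry u ∘ Ψ) z) := by
      funext z; rfl
    rw [hS, heq]
    exact locallyIntegrableOn_clm_apply (R : E →L[ℝ] E) (locallyIntegrableOn_comp_prodMap R.symm hu)
  · have heq : (fun z => ‖uncurry (fun t x => R (u t (R.symm x))) z‖ ^ 2) =
        (fun z => ‖uncurry u z‖ ^ 2) ∘ Ψ := by
      funext z
      simp only [comp_apply, uncurry, hΨ, LinearIsometryEquiv.norm_map]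
      rfl
    rw [hS, heq]
    exact locallyIntegrableOn_comp_prodMap R.symm hu2
  · have heq : uncurry (fun t x => p t (R.symm x)) = uncurry p ∘ Ψ := by
      funext z; rfl
    rw [hS, heq]
    exact locallyIntegrableOn_comp_prodMap R.symm hp
  · intro θ hθ
    have hθ'S : IsSpaceTimeTestOn (slab E I hI) (fun t y => θ t (R y)) :=
      isSpaceTimeTestOn_comp_lie hθ R
    have hzero := hdiv _ hθ'S
    set Fn : ℝ × E → ℝ := fun z => ⟪u z.1 z.2, gradient (fun y => θ z.1 (R y)) z.2⟫ with hFn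
    have key : ∀ z : ℝ × E, ⟪R (u z.1 (R.symm z.2)), gradient (θ z.1) z.2⟫ = Fn (Ψ z) := by
      intro z
      have hfun : θ z.1 = fun y => θ z.1 (R (R.symm y)) := by
        funext y; simp
      rw [hfun, gradient_comp_linearIsometryEquiv_symm R (fun y' => θ z.1 (R y')),
        LinearIsometryEquiv.inner_map_map]
      rfl
    rw [hS]
    refine (integral_congr_ae (ae_of_all _ fun z => ?_)).trans ((hcv Fn).trans hzero)
    exact key z
  · intro ψ hψ
    set ψ' : ℝ → E → E := fun t y => R.symm (ψ t (R y)) with hψ'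
    have hψ'S : IsSpaceTimeTestOn (slab E I hI) ψ' :=
      isSpaceTimeTestOn_clm_comp (isSpaceTimeTestOn_comp_lie hψ R) (R.symm : E →L[ℝ] E)
    have hzero := hns ψ' hψ'S
    have hrepr : ∀ t, ψ t = fun y => R (ψ' t (R.symm y)) := by
      intro t; funext y; simp [hψ']
    have htd : ∀ t x, timeDeriv ψ t x = R (timeDeriv ψ' t (R.symm x)) := by
      intro t x
      have h1 := timeDeriv_cle_comp R.symm.toContinuousLinearEquiv (fun s y => ψ s (R y)) t
        (R.symm x)
      have h2 : timeDeriv (fun s y => ψ s (R y)) t (R.symm x) = timeDeriv ψ t x := by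
        simp only [timeDeriv_apply, LinearIsometryEquiv.apply_symm_apply]
      have h3 : timeDeriv ψ' t (R.symm x) = R.symm (timeDeriv ψ t x) := by
        rw [← h2]; exact h1
      rw [h3, LinearIsometryEquiv.apply_symm_apply]
    set Fn : ℝ × E → ℝ := fun z => ⟪u z.1 z.2, timeDeriv ψ' z.1 z.2⟫ +
        ⟪u z.1 z.2, convect (u z.1) (ψ' z.1) z.2⟫ + ν * ⟪u z.1 z.2, Δ (ψ' z.1) z.2⟫ +
        p z.1 z.2 * VectorCalculus.divergence (ψ' z.1) z.2 + ⟪f z.1 z.2, ψ' z.1 z.2⟫ with hFn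
    have key : ∀ z : ℝ × E,
        ⟪R (u z.1 (R.symm z.2)), timeDeriv ψ z.1 z.2⟫ +
          ⟪R (u z.1 (R.symm z.2)), convect (fun x => R (u z.1 (R.symm x))) (ψ z.1) z.2⟫ +
          ν * ⟪R (u z.1 (R.symm z.2)), Δ (ψ z.1) z.2⟫ +
          p z.1 (R.symm z.2) * VectorCalculus.divergence (ψ z.1) z.2 +
          ⟪R (f z.1 (R.symm z.2)), ψ z.1 z.2⟫ = Fn (Ψ z) := by
      intro z
      rw [htd, hrepr z.1, convect_conj_linearIsometryEquiv, laplacian_conj_linearIsometryEquiv,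
        divergence_conj_linearIsometryEquiv]
      simp only [LinearIsometryEquiv.inner_map_map, hFn, hΨ]
      rfl
    rw [hS]
    refine (integral_congr_ae (ae_of_all _ fun z => ?_)).trans ((hcv Fn).trans hzero)
    exact key z

/-! ### Weak spatial gradients -/

/-- **Rotation covariance of weak spatial gradients on a slab** (CKN 1982, (2.1)): if `G` is a
weak spatial gradient of `u` on `I × E`, then `R ∘ G(t, R⁻¹x) ∘ R⁻¹` is one of `R u(t, R⁻¹x)`
(test the defining identity with `φ(t, R ·)` in the directions `R⁻¹ v`, `R⁻¹ w` and change
variables `x = R y` in the inner integrals). -/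
theorem hasWeakSpatialGradientOn_conj {I : Set ℝ} {hI : IsOpen I} {u : ℝ → E → E}
    {G : ℝ → E → E →L[ℝ] E} (h : HasWeakSpatialGradientOn (slab E I hI) u G)
    (R : E ≃ₗᵢ[ℝ] E) :
    HasWeakSpatialGradientOn (slab E I hI) (fun t x => R (u t (R.symm x)))
      (fun t x => (R : E →L[ℝ] E).comp ((G t (R.symm x)).comp (R.symm : E →L[ℝ] E))) := by
  set Ψ : ℝ × E → ℝ × E := Prod.map (id : ℝ → ℝ) (R.symm : E → E) with hΨ
  have hS : ((slab E I hI : Opens (ℝ × E)) : Set (ℝ × E)) = I ×ˢ univ := rfl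
  have hRmp : MeasurePreserving (R : E → E) volume volume := R.measurePreserving
  have hRemb : MeasurableEmbedding (R : E → E) := R.toHomeomorph.measurableEmbedding
  refine ⟨?_, ?_, fun φ hφ v w => ?_⟩
  · have heq : uncurry (fun t x => R (u t (R.symm x))) =
        fun z => (R : E →L[ℝ] E) ((uncurry u ∘ Ψ) z) := by
      funext z; rfl
    rw [hS, heq]
    exact locallyIntegrableOn_clm_apply (R : E →L[ℝ] E)
      (locallyIntegrableOn_comp_prodMap R.symm h.locallyIntegrableOn)
  · have heq :
        uncurry (fun t x => (R : E →L[ℝ] E).comp ((G t (R.symm x)).comp (R.symm : E →L[ℝ] E))) =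
        fun z => (ContinuousLinearMap.compL ℝ E E E (R : E →L[ℝ] E))
          (((ContinuousLinearMap.compL ℝ E E E).flip (R.symm : E →L[ℝ] E))
            ((uncurry G ∘ Ψ) z)) := by
      funext z; rfl
    rw [hS, heq]
    exact locallyIntegrableOn_clm_apply _ (locallyIntegrableOn_clm_apply _
      (locallyIntegrableOn_comp_prodMap R.symm h.locallyIntegrableOn_grad))
  · set φR : ℝ → E → ℝ := fun t y => φ t (R y) with hφR
    have hφR' : IsSpaceTimeTestOn (slab E I hI) φR := isSpaceTimeTestOn_comp_lie hφ R
    have key := h.integral_fderiv_mul_inner_eq φR hφR' (R.symm v) (R.symm w)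
    -- chain rule for the slices of `φR`
    have hchain : ∀ t y, fderiv ℝ (φR t) y (R.symm v) = fderiv ℝ (φ t) (R y) v := by
      intro t y
      have e : φR t = φ t ∘ (R.toContinuousLinearEquiv : E → E) := rfl
      rw [e, ContinuousLinearEquiv.comp_right_fderiv, ContinuousLinearMap.comp_apply]
      simp
    -- left-hand side: substitute `x = R y`
    have hL : ∀ t, ∫ x, fderiv ℝ (φ t) x v * ⟪R (u t (R.symm x)), w⟫ =
        ∫ y, fderiv ℝ (φR t) y (R.symm v) * ⟪u t y, R.symm w⟫ := by
      intro t
      rw [← hRmp.integral_comp hRemb (fun x => fderiv ℝ (φ t) x v * ⟪R (u t (R.symm x)), w⟫)]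
      refine integral_congr_ae (ae_of_all _ fun y => ?_)
      show fderiv ℝ (φ t) (R y) v * ⟪R (u t (R.symm (R y))), w⟫ =
        fderiv ℝ (φR t) y (R.symm v) * ⟪u t y, R.symm w⟫
      rw [hchain, LinearIsometryEquiv.symm_apply_apply, LinearIsometryEquiv.inner_map_eq_flip]
    -- right-hand side: substitute `x = R y`
    have hRt : ∀ t, ∫ x, φ t x *
        ⟪((R : E →L[ℝ] E).comp ((G t (R.symm x)).comp (R.symm : E →L[ℝ] E))) v, w⟫ =
        ∫ y, φR t y * ⟪G t y (R.symm v), R.symm w⟫ := by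
      intro t
      rw [← hRmp.integral_comp hRemb (fun x => φ t x *
        ⟪((R : E →L[ℝ] E).comp ((G t (R.symm x)).comp (R.symm : E →L[ℝ] E))) v, w⟫)]
      refine integral_congr_ae (ae_of_all _ fun y => ?_)
      show φ t (R y) *
          ⟪((R : E →L[ℝ] E).comp ((G t (R.symm (R y))).comp (R.symm : E →L[ℝ] E))) v, w⟫ =
        φR t y * ⟪G t y (R.symm v), R.symm w⟫
      simp only [ContinuousLinearMap.comp_apply, LinearIsometryEquiv.coe_coe'',
        LinearIsometryEquiv.symm_apply_apply]
      rw [LinearIsometryEquiv.inner_map_eq_flip]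
    simp_rw [hL, hRt]
    exact key

end Summit.NavierStokesRegularity.NavierStokesRegularity.Theorems.RellichScarSimilarityCovariance
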